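import Summits.QuantumFields.YangMills.Theorems.LuscherReductionTwistedTraceScalingTowerOfUniform
import Summits.QuantumFields.YangMills.Theorems.TwistedTraceScaling.Negative.FixedLatticeTraceLawFalseWithoutThreshold
import Summits.QuantumFields.YangMills.Theorems.TwistedTraceScaling.Negative.StrongCouplingBranch
import HarnessLib

/-!
# `TwistedTraceScaling` (crux stmt-QuantumFields-20203, route `LuscherReduction`, skeleton «twolattice»):
# negative-side support IV — in the stub S-TOWER the hypothesis `1 ≤ β₁` is load-bearing (modulo S-BASE)
# (refuter crux-disprover seat; this file does NOT refute the crux or any stub)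

HONEST FRAMING: `TwistedTraceScaling` is a femto-rung (R2b1) crux of a CONDITIONAL reduction route; nothing here is a
mass-gap or Clay statement.  All objects are the tree's: `TraceDoor.traceRatio`, `TraceDoor.femtoSteps`, `TraceDoor.hTraceRatio`,
`InFemtoWindow`, `luscherLambda`, `invRunningCoupling`.

The skeleton's S-TOWER stub `stub_twoLatticeUniversality` compares the `L`-lattice at a window coupling `β` with the `L₁`-lattice at
ANY `β₁ ≥ 1` matched by the two-loop label, `invRunningCoupling β₁ L₁ = invRunningCoupling β L`.  The matching equation has a second,
strong-coupling root `0 < β₁ < 1` (`StrongCouplingBranch.exists_strong_matched`), at which `traceRatio L₁ β₁ T ≥ 1 − 4cβ₁T` is as close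
to `1` as we please (`one_sub_le_traceRatio`), whereas the weak-coupling side is near `r_𝔥(s) < 1` — but the latter is exactly the
content of the other stub S-BASE (`stub_fixedLatticeTraceLaw`), which is open.  Hence the kernel-checked statement of this file is the
implication

  `twoLatticeUniversality_false_without_beta1GeOne_of_base : S-BASE → ¬ (S-TOWER with «1 ≤ β₁ →» deleted)`,

both stubs spelled out VERBATIM from the registered skeleton `Lines-twolattice.lean` (sha a5c3dbcbf75f28d1) as hypothesis / negated
conclusion (no proposition is defined under `Summits/`).  Witness: `s = 1`, `ε = (1 − r_𝔥(1))/4`, `L = L₁ = L0 + 1`, the weak root `β ≥ 1`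
of `Λ(β, L0+1) = lam` (`Tower.exists_matched`, so `InFemtoWindow lam β (L0+1)` and `β ≥ 1/(4lam³)` is above the S-BASE threshold), and
the strong root `β₁` of the SAME label value.  Moral for the TOWER lane: any proof of S-TOWER must use `1 ≤ β₁` (it is what makes
`Tower.matched_ge` / `window_of_matched` available); and a planner must not weaken the stub to unrestricted matched couplings.
This is an ordinary negative lemma with S-BASE as an explicit hypothesis — it holds no verdict on S-BASE or S-TOWER themselves.
-/

set_option autoImplicit false

noncomputable section

open MeasureTheory Filter Topology Real
open Literature.MathematicalPhysics.QuantumFieldTheory hiding SU2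
open Literature.MathematicalPhysics.QuantumLattice
open scoped BigOperators

namespace Summit.QuantumFields.YangMills.Theorems.TwistedTraceScaling.Negative

open Summit.QuantumFields.YangMills.Theorems.FemtoTransferGap
open Summit.QuantumFields.YangMills.Theorems.FemtoTransferGap.TraceDoor
open Summit.QuantumFields.YangMills.Theorems.FemtoTransferGap.TT
open Summit.QuantumFields.YangMills.Theorems.FemtoTransferGap.TwoLattice

/-- **S-TOWER without `1 ≤ β₁` is false, given S-BASE.**  Hypothesis = the skeleton's `Stmt.stub_fixedLatticeTraceLaw` verbatim;
negated conclusion = `Stmt.stub_twoLatticeUniversality` verbatim with the binder `1 ≤ β₁ →` deleted.  Witness: `s = 1`, `L = L₁ = L0+1`,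
`β` the weak and `β₁` the strong root of the same label value `1/lam³`. [folklore] -/
theorem twoLatticeUniversality_false_without_beta1GeOne_of_base
    (hBASE : ∀ (L1 : ℕ) [NeZero L1] (s : ℝ), 0 < s → ∀ ε : ℝ, 0 < ε → ∃ β1 : ℝ, ∀ β : ℝ, β1 ≤ β →
      |traceRatio L1 β (femtoSteps s β L1) - hTraceRatio s| ≤ ε) :
    ¬ (∀ s : ℝ, 0 < s → ∀ ε : ℝ, 0 < ε → ∃ L0 : ℕ, ∃ lam0 : ℝ, 0 < lam0 ∧ ∀ lam : ℝ, 0 < lam → lam ≤ lam0 →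
        ∀ (L1 : ℕ) [NeZero L1], L0 ≤ L1 → ∀ (L : ℕ) [NeZero L], L1 ≤ L → ∀ β : ℝ, InFemtoWindow lam β L →
          ∀ β₁ : ℝ, invRunningCoupling β₁ L1 = invRunningCoupling β L →
            |traceRatio L β (femtoSteps s β L) - traceRatio L1 β₁ (femtoSteps s β₁ L1)| ≤ ε) := by
  intro h
  have hr1 : hTraceRatio 1 < 1 := hTraceRatio_lt_one one_pos
  obtain ⟨g, hg⟩ : ∃ g : ℝ, g = 1 - hTraceRatio 1 := ⟨_, rfl⟩
  have hg0 : 0 < g := by rw [hg]; linarith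
  obtain ⟨L0, lam0, hlam0, H⟩ := h 1 one_pos (g / 4) (by positivity)
  obtain ⟨βthr, hB⟩ := hBASE (L0 + 1) 1 one_pos (g / 4) (by positivity)
  have hb0 : 0 < b0 := by unfold b0; positivity
  have hb1 : 0 < b1 := by unfold b1; positivity
  obtain ⟨c, hc⟩ : ∃ c : ℝ,
      c = 2 * (Fintype.card (Edge 3 (L0 + 1)) : ℝ) + 4 * (Fintype.card (Plaquette 3 (L0 + 1)) : ℝ) := ⟨_, rfl⟩
  have hcnn : 0 ≤ c := by rw [hc]; positivity
  obtain ⟨κ, hκ⟩ : ∃ κ : ℝ, κ = b0 / b1 := ⟨_, rfl⟩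
  have hκ0 : 0 < κ := by rw [hκ]; exact div_pos hb0 hb1
  obtain ⟨N, hN⟩ : ∃ N : ℝ, N = ((L0 + 1 : ℕ) : ℝ) + 1 := ⟨_, rfl⟩
  have hN0 : 0 < N := by rw [hN]; positivity
  obtain ⟨C, hC⟩ : ∃ C : ℝ, C = 8 * c * b0 * Real.exp (κ / 2) * N / κ + 1 := ⟨_, rfl⟩
  have hC0 : 0 < C := by rw [hC]; positivity
  obtain ⟨M, hM⟩ : ∃ M : ℝ, M = max βthr 1 := ⟨_, rfl⟩
  have hM1 : 1 ≤ M := by rw [hM]; exact le_max_right _ _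
  have hMB : βthr ≤ M := by rw [hM]; exact le_max_left _ _
  have hM0 : 0 < M := by linarith
  -- the depth `lam`
  obtain ⟨lam, hlam_pos, hlam_le0, hlam_half, hlam_M, hlam_g⟩ :
      ∃ lam : ℝ, 0 < lam ∧ lam ≤ lam0 ∧ lam ≤ 1 / 2 ∧ lam ≤ 1 / M ∧ lam ≤ g / (4 * C) := by
    refine ⟨min lam0 (min (1 / 2) (min (1 / M) (g / (4 * C)))),
      lt_min hlam0 (lt_min (by norm_num) (lt_min (by positivity) (by positivity))), min_le_left _ _,
      (min_le_right _ _).trans (min_le_left _ _),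
      (min_le_right _ _).trans ((min_le_right _ _).trans (min_le_left _ _)),
      (min_le_right _ _).trans ((min_le_right _ _).trans (min_le_right _ _))⟩
  have hlam_one : lam ≤ 1 := by linarith
  -- the weak root `β ≥ 1` of `Λ(β, L0+1) = lam`, inside the window
  have hv : (1 : ℝ) ≤ 1 / lam ^ 3 := by
    rw [le_div_iff₀ (by positivity)]
    have : lam ^ 3 ≤ 1 := pow_le_one₀ hlam_pos.le hlam_one
    linarith
  obtain ⟨β, hβ1, hval⟩ := Tower.exists_matched (L0 + 1) hv
  have hvpos : 0 < invRunningCoupling β (L0 + 1) := by rw [hval]; positivity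
  have h3 : luscherLambda β (L0 + 1) ^ 3 = lam ^ 3 := by
    rw [BOHandover.luscherLambda_pow_three hvpos, hval, one_div, inv_inv]
  have hnn : 0 ≤ luscherLambda β (L0 + 1) := by
    unfold luscherLambda; exact Real.rpow_nonneg (le_max_right _ _) _
  have hΛ : luscherLambda β (L0 + 1) = lam := (pow_left_inj₀ hnn hlam_pos.le (by norm_num : (3 : ℕ) ≠ 0)).1 h3
  have hW : InFemtoWindow lam β (L0 + 1) := ⟨hβ1, by rw [hΛ], by rw [hΛ]; linarith⟩
  -- the strong root `β₁ < 1` of the SAME label value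
  obtain ⟨β₁, hβ₁0, -, hβ₁le, hval₁⟩ := exists_strong_matched (L0 + 1) hv
  have hmatch : invRunningCoupling β₁ (L0 + 1) = invRunningCoupling β (L0 + 1) := by rw [hval₁, hval]
  have hΛ₁ : luscherLambda β₁ (L0 + 1) = lam := by
    have h1 : luscherLambda β₁ (L0 + 1) = luscherLambda β (L0 + 1) := by unfold luscherLambda; rw [hmatch]
    rw [h1, hΛ]
  -- the hypothesis at `(lam, L1 = L = L0+1, β, β₁)`
  have hH := H lam hlam_pos hlam_le0 (L0 + 1) (Nat.le_succ L0) (L0 + 1) le_rfl β hW β₁ hmatch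
  obtain ⟨T, hT⟩ : ∃ T : ℕ, T = femtoSteps 1 β (L0 + 1) := ⟨_, rfl⟩
  have hT' : femtoSteps 1 β₁ (L0 + 1) = T := by rw [hT]; unfold femtoSteps; rw [hΛ, hΛ₁]
  rw [← hT, hT'] at hH
  -- S-BASE applies at the weak root: `β ≥ 1/(4lam³) ≥ βthr`
  have hβ_large : βthr ≤ β := by
    have h1 : 1 / (4 * lam ^ 3) ≤ β := BOHandover.beta_ge_of_window hlam_pos hW
    have h2 : M ≤ 1 / lam := by
      rw [le_div_iff₀ hlam_pos]
      calc M * lam ≤ M * (1 / M) := mul_le_mul_of_nonneg_left hlam_M hM0.le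
        _ = 1 := by field_simp
    have h3 : 1 / lam ≤ 1 / (4 * lam ^ 3) := by
      rw [div_le_div_iff₀ hlam_pos (by positivity)]
      have h4 : lam ^ 2 ≤ 1 / 4 := by nlinarith
      nlinarith
    linarith
  have hBw := hB β hβ_large
  rw [← hT] at hBw
  -- the strong side: `traceRatio (L0+1) β₁ T ≥ 1 − 4cβ₁T ≥ 1 − g/4`
  have hT1 : 1 ≤ T := by
    rw [hT]; unfold femtoSteps; rw [hΛ]
    exact Nat.ceil_pos.mpr (by positivity)
  have hlow := one_sub_le_traceRatio (L0 + 1) hβ₁0.le hT1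
  rw [← hc] at hlow
  have hTle : (T : ℝ) ≤ N / lam := by
    have h1 : (T : ℝ) < 1 * ((L0 + 1 : ℕ) : ℝ) / lam + 1 := by
      rw [hT]; unfold femtoSteps; rw [hΛ]; exact Nat.ceil_lt_add_one (by positivity)
    have h2 : (1 : ℝ) ≤ 1 / lam := by rw [le_div_iff₀ hlam_pos]; linarith
    have h3 : N / lam = 1 * ((L0 + 1 : ℕ) : ℝ) / lam + 1 / lam := by rw [hN]; ring
    linarith
  have hsmall : 4 * (c * β₁) * T ≤ g / 4 := by
    have he : Real.exp (-(b0 / b1) * (1 / lam ^ 3 - 1 / 2)) = Real.exp (κ / 2) * Real.exp (-(κ / lam ^ 3)) := by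
      rw [← Real.exp_add, hκ]; congr 1; ring
    have hx : 0 < κ / lam ^ 3 := by positivity
    have hex : Real.exp (-(κ / lam ^ 3)) ≤ lam ^ 3 / κ := by
      have h1 : κ / lam ^ 3 + 1 ≤ Real.exp (κ / lam ^ 3) := Real.add_one_le_exp _
      rw [Real.exp_neg]
      calc (Real.exp (κ / lam ^ 3))⁻¹ ≤ (κ / lam ^ 3)⁻¹ := inv_anti₀ hx (by linarith)
        _ = lam ^ 3 / κ := by rw [inv_div]
    have hβ' : β₁ ≤ 2 * b0 * Real.exp (κ / 2) * (lam ^ 3 / κ) := by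
      calc β₁ ≤ 2 * b0 * Real.exp (-(b0 / b1) * (1 / lam ^ 3 - 1 / 2)) := hβ₁le
        _ = 2 * b0 * Real.exp (κ / 2) * Real.exp (-(κ / lam ^ 3)) := by rw [he]; ring
        _ ≤ 2 * b0 * Real.exp (κ / 2) * (lam ^ 3 / κ) := mul_le_mul_of_nonneg_left hex (by positivity)
    have hE0 : 0 < Real.exp (κ / 2) := Real.exp_pos _
    calc 4 * (c * β₁) * T ≤ 4 * (c * (2 * b0 * Real.exp (κ / 2) * (lam ^ 3 / κ))) * (N / lam) := by
          apply mul_le_mul _ hTle (by positivity) (by positivity)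
          exact mul_le_mul_of_nonneg_left (mul_le_mul_of_nonneg_left hβ' hcnn) (by norm_num)
      _ = (8 * c * b0 * Real.exp (κ / 2) * N / κ) * lam ^ 2 := by field_simp; ring
      _ ≤ C * lam ^ 2 := by
          apply mul_le_mul_of_nonneg_right _ (by positivity)
          rw [hC]; linarith
      _ ≤ C * lam := by
          apply mul_le_mul_of_nonneg_left _ hC0.le
          have h1 : lam ^ 2 = lam * lam := by ring
          rw [h1]
          exact mul_le_of_le_one_right hlam_pos.le hlam_one
      _ ≤ C * (g / (4 * C)) := mul_le_mul_of_nonneg_left hlam_g hC0.le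
      _ = g / 4 := by field_simp
  -- contradiction
  have h1 : -(g / 4) ≤ traceRatio (L0 + 1) β T - traceRatio (L0 + 1) β₁ T := (abs_le.mp hH).1
  have h2 : traceRatio (L0 + 1) β T - hTraceRatio 1 ≤ g / 4 := (abs_le.mp hBw).2
  linarith only [hlow, hsmall, h1, h2, hg, hg0]

end Summit.QuantumFields.YangMills.Theorems.TwistedTraceScaling.Negative

end
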